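/- Width seat `ym-line-cbag-p1-w2` (prover-ym-line-cbag-p1-w2-g14-0; own items stmt-QuantumFields-22254 / 22893 CLOSED) on the
planner-of-record's LINE 5, route `HankelDensitySplitting`: REGISTERED STUB B `stub_freeKernelMargin : FreeKernelMargin` of the birth
skeleton v2 (sha 21a8c843…) of crux `LogWindowMixedDominance` (stmt-QuantumFields-26617), BY NAME.  Pure lattice Maxwell theory; RECORD-type
material (node `LatticeNonFreezing`); the Yang–Mills mass gap is NOT proved by anything here, and the crux stays open (stub A, the
power-saving mixed-pair CLT, is the wall). -/
import Summits.QuantumFields.YangMills.Theorems.LogWindowMixedDominanceKernelDecay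
import Summits.QuantumFields.YangMills.Theorems.HankelDensitySplittingLogWindowMixedDominanceDefs
import Summits.QuantumFields.YangMills.Theorems.DirichletWindowLocalGaussianityAxialKernel
import HarnessLib

/-!
# Crux `LogWindowMixedDominance` (stmt-QuantumFields-26617), stub B: `stub_freeKernelMargin`

`FreeKernelMargin` (`Theorems/HankelDensitySplittingLogWindowMixedDominanceDefs.lean`): there are `γ > 0` and `n₁ ≥ 1` with
`γ/n⁸ ≤ T_free(n) − G_free(n−1) + 2·G_free(n)` for all `n ≥ n₁`, where `T_free(n) = Σ_{0<j, k<l} K((0;0,j),(n e₀;k,l))²` and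
`G_free(m) = Σ_{0<i<j, k<l} K((0;i,j),(m e₀;k,l))²` are the temporal and spatial parts of the free (lattice-Maxwell, `curvatureTwoPoint`)
density–density kernel along the time axis.

Proof (orders of magnitude only — no matching of asymptotic constants is needed):
* `T_free(n) + G_free(n) ≥ K((0;0,1),(n e₀;0,1))² ≥ κ₀²/n⁸`, `κ₀ = (2/3)(2π)⁻³/32768`, by the landed Källén–Lehmann floor for the in-plane axial
  kernel `AxialKernel.abs_curvatureTwoPoint_inPlane_ge`;
* `|G_free(n) − G_free(n−1)| ≤ Σ |K_n − K_{n−1}|·(|K_n| + |K_{n−1}|) ≤ C/(n−1)⁹ ≤ 2⁹C/n⁹` by the dipole-type decay of the spatial–arbitrary kernel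
  `|K_m| ≤ A/m⁴`, `|K_{m+1} − K_m| ≤ B/m⁵` (`KernelDecay.abs_kernel_le`, `abs_kernel_succ_sub_le`: double-curl expansion + decay of second/third
  differences of the `d = 4` lattice Green function via its transfer-matrix representation);
* hence the margin `= [T(n)+G(n)] + [G(n) − G(n−1)] ≥ κ₀²/n⁸ − 2¹⁸AB/n⁹ ≥ κ₀²/(2n⁸)` for `n ≥ max(2, 2¹⁹AB/κ₀²)`.
Tree-level numerics of the planner's falsifier (kit j303389): margin holds from `n = 9` with `n⁸T, n⁸G → 0.0308`; the threshold proved here is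
not optimised.  No sorry; standard axioms.  NOT the Yang–Mills mass gap; the crux `LogWindowMixedDominance` is not proved here.
-/

set_option autoImplicit false

noncomputable section

namespace Summit.QuantumFields.YangMills.Theorems.HankelDensitySplitting.LogWindow

open Real Literature.Probability.LatticeModels
open Literature.MathematicalPhysics.QuantumFieldTheory Literature.MathematicalPhysics.QuantumLattice

/-! ### The axial floor inside `T_free` -/

/-- The in-plane axial term of `T_free`: `kFree n 0 1 0 1` is the tree's in-plane axial kernel `curvatureTwoPoint (0;0,1) (n e₀;0,1)`. -/
theorem kFree_axial_eq (n : ℕ) :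
    kFree n 0 1 0 1 = curvatureTwoPoint (d := 4)
      (((0 : Site 4), ⟨((0 : Fin 4), (1 : Fin 4)), Fin.zero_lt_one⟩) : ZdPlaquette 4)
      (((Pi.single (0 : Fin 4) (n : ℤ) : Site 4)), ⟨((0 : Fin 4), (1 : Fin 4)), Fin.zero_lt_one⟩) := by
  have h01 : (0 : Fin 4) < 1 ∧ (0 : Fin 4) < 1 := ⟨Fin.zero_lt_one, Fin.zero_lt_one⟩
  have e : ((n : ℤ) • Pi.single (0 : Fin 4) (1 : ℤ) : Site 4) = Pi.single (0 : Fin 4) (n : ℤ) := by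
    ext i
    by_cases hi : i = 0
    · subst hi; simp
    · simp [hi]
  simp only [kFree, dif_pos h01, axisSite, e]

/-- `T_free(n) ≥ κ₀²/n⁸` for `n ≥ 1` (the axial square alone; every other summand is a square). -/
theorem tFree_ge (n : ℕ) (hn : 1 ≤ n) : (2 / 3 / (2 * π) ^ 3 / 32768) ^ 2 / (n : ℝ) ^ 8 ≤ tFree n := by
  have hax := LocalGaussianityExpMomentTangentLaw.AxialKernel.abs_curvatureTwoPoint_inPlane_ge n hn
  rw [← kFree_axial_eq] at hax
  have hn0 : (0 : ℝ) < n := by exact_mod_cast hn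
  have hsq : (2 / 3 / (2 * π) ^ 3 / 32768) ^ 2 / (n : ℝ) ^ 8 ≤ kFree n 0 1 0 1 ^ 2 := by
    have h0 : 0 ≤ 2 / 3 / (2 * π) ^ 3 / 32768 / (n : ℝ) ^ 4 := by positivity
    have h1 := pow_le_pow_left₀ h0 hax 2
    rw [sq_abs] at h1
    calc (2 / 3 / (2 * π) ^ 3 / 32768) ^ 2 / (n : ℝ) ^ 8 = (2 / 3 / (2 * π) ^ 3 / 32768 / (n : ℝ) ^ 4) ^ 2 := by
          rw [div_pow _ ((n : ℝ) ^ 4), ← pow_mul]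
      _ ≤ kFree n 0 1 0 1 ^ 2 := h1
  have hnn : ∀ j k l : Fin 4, 0 ≤ (if 0 < j ∧ k < l then kFree n 0 j k l ^ 2 else 0) := by
    intro j k l
    split_ifs
    · positivity
    · exact le_rfl
  have h01 : (0 : Fin 4) < 1 ∧ (0 : Fin 4) < 1 := ⟨Fin.zero_lt_one, Fin.zero_lt_one⟩
  refine hsq.trans ?_
  unfold tFree
  calc kFree n 0 1 0 1 ^ 2 = (if (0 : Fin 4) < 1 ∧ (0 : Fin 4) < 1 then kFree n 0 1 0 1 ^ 2 else 0) := by rw [if_pos h01]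
    _ ≤ ∑ l : Fin 4, (if (0 : Fin 4) < 1 ∧ (0 : Fin 4) < l then kFree n 0 1 0 l ^ 2 else 0) :=
        Finset.single_le_sum (f := fun l : Fin 4 => if (0 : Fin 4) < 1 ∧ (0 : Fin 4) < l then kFree n 0 1 0 l ^ 2 else 0)
          (fun l _ => hnn 1 0 l) (Finset.mem_univ (1 : Fin 4))
    _ ≤ ∑ k : Fin 4, ∑ l : Fin 4, (if (0 : Fin 4) < 1 ∧ k < l then kFree n 0 1 k l ^ 2 else 0) :=
        Finset.single_le_sum (f := fun k : Fin 4 => ∑ l : Fin 4, if (0 : Fin 4) < 1 ∧ k < l then kFree n 0 1 k l ^ 2 else 0)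
          (fun k _ => Finset.sum_nonneg fun l _ => hnn 1 k l) (Finset.mem_univ (0 : Fin 4))
    _ ≤ ∑ j : Fin 4, ∑ k : Fin 4, ∑ l : Fin 4, (if 0 < j ∧ k < l then kFree n 0 j k l ^ 2 else 0) :=
        Finset.single_le_sum (f := fun j : Fin 4 => ∑ k : Fin 4, ∑ l : Fin 4, if 0 < j ∧ k < l then kFree n 0 j k l ^ 2 else 0)
          (fun j _ => Finset.sum_nonneg fun k _ => Finset.sum_nonneg fun l _ => hnn j k l) (Finset.mem_univ (1 : Fin 4))

/-- `G_free(m) ≥ 0`. -/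
theorem gFree_nonneg (m : ℕ) : 0 ≤ gFree m := by
  unfold gFree
  refine Finset.sum_nonneg fun i _ => Finset.sum_nonneg fun j _ => Finset.sum_nonneg fun k _ =>
    Finset.sum_nonneg fun l _ => ?_
  split_ifs
  · positivity
  · exact le_rfl

/-! ### Slow variation of `G_free` -/

/-- Uniform constants for the kernel decay: `|K_m| ≤ A/m⁴` (`m ≥ 1`) and `|K_{n+1} − K_n| ≤ B/n⁵` (`n ≥ 1`) for the spatial planes
`0 < i < j` against all planes `k < l`. -/
theorem kernel_constants :
    ∃ A B : ℝ, 0 ≤ A ∧ 0 ≤ B ∧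
      (∀ (i j k l : Fin 4), 0 < i → i < j → k < l → ∀ m : ℕ, 1 ≤ m → |kFree m i j k l| ≤ A / (m : ℝ) ^ 4) ∧
      (∀ (i j k l : Fin 4), 0 < i → i < j → k < l → ∀ n : ℕ, 1 ≤ n →
        |kFree (n + 1) i j k l - kFree n i j k l| ≤ B / (n : ℝ) ^ 5) := by
  have hK : ∀ (i j k l : Fin 4) (hij : i < j) (hkl : k < l) (m : ℕ), kFree m i j k l =
      curvatureTwoPoint (d := 4) (((0 : Site 4), ⟨(i, j), hij⟩) : ZdPlaquette 4)
        ((((m : ℤ) • Pi.single (0 : Fin 4) (1 : ℤ) : Site 4), ⟨(k, l), hkl⟩) : ZdPlaquette 4) := by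
    intro i j k l hij hkl m
    simp only [kFree, axisSite, dif_pos (And.intro hij hkl)]
  refine ⟨2 * (π / 2 * (2 * 12 ^ 3 / (2 / (3 * π)) ^ 4)) / (2 * π) ^ 3,
    2 * (7 * (16 * 12 ^ 3 / (2 / (3 * π)) ^ 5)) / (2 * π) ^ 3, by positivity, by positivity, ?_, ?_⟩
  · intro i j k l hi hij hkl m hm
    rw [hK i j k l hij hkl]
    refine (KernelDecay.abs_kernel_le i j k l hi hij hkl hm).trans (le_of_eq ?_)
    ring
  · intro i j k l hi hij hkl n hn
    rw [hK i j k l hij hkl, hK i j k l hij hkl]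
    refine (KernelDecay.abs_kernel_succ_sub_le i j k l hi hij hkl hn).trans (le_of_eq ?_)
    ring

/-- **Slow variation of the spatial part**: `|G_free(n+1) − G_free(n)| ≤ 512·A·B/n⁹` for `n ≥ 1`. -/
theorem abs_gFree_succ_sub_le {A B : ℝ} (hA : 0 ≤ A) (hB : 0 ≤ B)
    (h4 : ∀ (i j k l : Fin 4), 0 < i → i < j → k < l → ∀ m : ℕ, 1 ≤ m → |kFree m i j k l| ≤ A / (m : ℝ) ^ 4)
    (h5 : ∀ (i j k l : Fin 4), 0 < i → i < j → k < l → ∀ n : ℕ, 1 ≤ n →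
      |kFree (n + 1) i j k l - kFree n i j k l| ≤ B / (n : ℝ) ^ 5)
    {n : ℕ} (hn : 1 ≤ n) :
    |gFree (n + 1) - gFree n| ≤ 512 * A * B / (n : ℝ) ^ 9 := by
  have hn0 : (0 : ℝ) < n := by exact_mod_cast hn
  set E : ℝ := B / (n : ℝ) ^ 5 * (2 * (A / (n : ℝ) ^ 4)) with hE
  have hE0 : 0 ≤ E := by positivity
  -- termwise bound
  have hterm : ∀ i j k l : Fin 4,
      |(if 0 < i ∧ i < j ∧ k < l then kFree (n + 1) i j k l ^ 2 else 0) -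
        (if 0 < i ∧ i < j ∧ k < l then kFree n i j k l ^ 2 else 0)| ≤ E := by
    intro i j k l
    by_cases hP : 0 < i ∧ i < j ∧ k < l
    · rw [if_pos hP, if_pos hP]
      have ha := h4 i j k l hP.1 hP.2.1 hP.2.2 (n + 1) (by omega)
      have hb := h4 i j k l hP.1 hP.2.1 hP.2.2 n hn
      have hd := h5 i j k l hP.1 hP.2.1 hP.2.2 n hn
      have hn1 : A / ((n + 1 : ℕ) : ℝ) ^ 4 ≤ A / (n : ℝ) ^ 4 := by
        refine div_le_div_of_nonneg_left hA (by positivity) ?_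
        exact pow_le_pow_left₀ hn0.le (by push_cast; linarith) 4
      have hsum : |kFree (n + 1) i j k l + kFree n i j k l| ≤ 2 * (A / (n : ℝ) ^ 4) := by
        refine (abs_add_le _ _).trans ?_
        linarith [ha.trans hn1]
      rw [sq_sub_sq, abs_mul]
      calc |kFree (n + 1) i j k l + kFree n i j k l| * |kFree (n + 1) i j k l - kFree n i j k l|
          ≤ 2 * (A / (n : ℝ) ^ 4) * (B / (n : ℝ) ^ 5) := mul_le_mul hsum hd (abs_nonneg _) (by positivity)
        _ = E := by rw [hE]; ring
    · rw [if_neg hP, if_neg hP, sub_zero, abs_zero]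
      exact hE0
  -- sum
  have hdiff : gFree (n + 1) - gFree n = ∑ i : Fin 4, ∑ j : Fin 4, ∑ k : Fin 4, ∑ l : Fin 4,
      ((if 0 < i ∧ i < j ∧ k < l then kFree (n + 1) i j k l ^ 2 else 0) -
        (if 0 < i ∧ i < j ∧ k < l then kFree n i j k l ^ 2 else 0)) := by
    simp only [gFree, ← Finset.sum_sub_distrib]
  have hup : gFree (n + 1) - gFree n ≤ 256 * E := by
    rw [hdiff]
    calc (∑ i : Fin 4, ∑ j : Fin 4, ∑ k : Fin 4, ∑ l : Fin 4,
          ((if 0 < i ∧ i < j ∧ k < l then kFree (n + 1) i j k l ^ 2 else 0) -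
            (if 0 < i ∧ i < j ∧ k < l then kFree n i j k l ^ 2 else 0)))
        ≤ ∑ _i : Fin 4, ∑ _j : Fin 4, ∑ _k : Fin 4, ∑ _l : Fin 4, E := by
          gcongr with i _ j _ k _ l _
          exact (le_abs_self _).trans (hterm i j k l)
      _ = 256 * E := by
          simp only [Finset.sum_const, Finset.card_univ, Fintype.card_fin]
          ring
  have hlo : -(256 * E) ≤ gFree (n + 1) - gFree n := by
    rw [hdiff]
    calc -(256 * E) = ∑ _i : Fin 4, ∑ _j : Fin 4, ∑ _k : Fin 4, ∑ _l : Fin 4, (-E) := by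
          simp only [Finset.sum_const, Finset.card_univ, Fintype.card_fin]
          ring
      _ ≤ ∑ i : Fin 4, ∑ j : Fin 4, ∑ k : Fin 4, ∑ l : Fin 4,
          ((if 0 < i ∧ i < j ∧ k < l then kFree (n + 1) i j k l ^ 2 else 0) -
            (if 0 < i ∧ i < j ∧ k < l then kFree n i j k l ^ 2 else 0)) := by
          gcongr with i _ j _ k _ l _
          exact (neg_le.1 ((neg_le_abs _).trans (hterm i j k l)))
  have hfin : 256 * E = 512 * A * B / (n : ℝ) ^ 9 := by
    rw [hE]
    field_simp
    ring
  rw [abs_le, ← hfin]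
  exact ⟨hlo, hup⟩

/-! ### Stub B -/

/-- **STUB B of the registered skeleton v2 of crux `LogWindowMixedDominance` (stmt-QuantumFields-26617), proved: `FreeKernelMargin`.**
With `κ₀ = (2/3)(2π)⁻³/32768` and the kernel-decay constants `A, B` of `kernel_constants`: for `n ≥ max 2 ⌈2¹⁹AB/κ₀²⌉`,
`κ₀²/(2n⁸) ≤ T_free(n) − G_free(n−1) + 2·G_free(n)` — the free (lattice-Maxwell) `n⁻⁸` margin of the crux inequality.  Pure lattice Maxwell
theory; NOT the Yang–Mills mass gap; the crux stays open (stub A `MixedPairsPowerSavingCLT`). -/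
theorem stub_freeKernelMargin : FreeKernelMargin := by
  obtain ⟨A, B, hA, hB, h4, h5⟩ := kernel_constants
  set κ : ℝ := 2 / 3 / (2 * π) ^ 3 / 32768 with hκ
  have hκpos : 0 < κ := by positivity
  refine ⟨κ ^ 2 / 2, max 2 ⌈2 ^ 19 * A * B / κ ^ 2⌉₊, by positivity, le_trans (by norm_num) (le_max_left _ _), fun n hn => ?_⟩
  have hn2 : 2 ≤ n := (le_max_left _ _).trans hn
  have hnceil : (2 ^ 19 * A * B / κ ^ 2 : ℝ) ≤ n :=
    (Nat.le_ceil _).trans (by exact_mod_cast (le_max_right _ _).trans hn)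
  obtain ⟨m, rfl⟩ : ∃ m, n = m + 1 := ⟨n - 1, by omega⟩
  have hm : 1 ≤ m := by omega
  rw [Nat.add_sub_cancel]
  have hm0 : (0 : ℝ) < m := by exact_mod_cast hm
  have hn0 : (0 : ℝ) < ((m + 1 : ℕ) : ℝ) := by positivity
  -- the three inputs
  have hT := tFree_ge (m + 1) (by omega)
  have hG := gFree_nonneg (m + 1)
  have hV := abs_gFree_succ_sub_le hA hB h4 h5 hm
  rw [← hκ] at hT
  -- (m+1) ≤ 2m, so 1/m⁹ ≤ 2⁹/(m+1)⁹
  have hmn : ((m + 1 : ℕ) : ℝ) ≤ 2 * m := by push_cast; linarith [show (1 : ℝ) ≤ m from by exact_mod_cast hm]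
  have hpow : ((m + 1 : ℕ) : ℝ) ^ 9 ≤ 2 ^ 9 * (m : ℝ) ^ 9 := by
    calc ((m + 1 : ℕ) : ℝ) ^ 9 ≤ (2 * (m : ℝ)) ^ 9 := pow_le_pow_left₀ hn0.le hmn 9
      _ = 2 ^ 9 * (m : ℝ) ^ 9 := by ring
  have hV' : |gFree (m + 1) - gFree m| ≤ 2 ^ 18 * A * B / ((m + 1 : ℕ) : ℝ) ^ 9 := by
    refine hV.trans ?_
    rw [div_le_div_iff₀ (by positivity) (by positivity)]
    have hAB : 0 ≤ A * B := mul_nonneg hA hB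
    nlinarith [mul_le_mul_of_nonneg_left hpow (show 0 ≤ 512 * A * B from by positivity)]
  -- the threshold: 2¹⁸AB/n⁹ ≤ κ²/(2n⁸)
  have hthr : 2 ^ 18 * A * B / ((m + 1 : ℕ) : ℝ) ^ 9 ≤ κ ^ 2 / 2 / ((m + 1 : ℕ) : ℝ) ^ 8 := by
    rw [div_le_div_iff₀ (by positivity) (by positivity)]
    have h1 : 2 ^ 19 * A * B ≤ κ ^ 2 * ((m + 1 : ℕ) : ℝ) := by
      have := hnceil
      rw [div_le_iff₀ (by positivity)] at this
      linarith
    have h8 : 0 ≤ ((m + 1 : ℕ) : ℝ) ^ 8 := by positivity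
    nlinarith [mul_le_mul_of_nonneg_right h1 h8]
  -- assemble
  have key : κ ^ 2 / ((m + 1 : ℕ) : ℝ) ^ 8 - 2 ^ 18 * A * B / ((m + 1 : ℕ) : ℝ) ^ 9 ≤
      tFree (m + 1) - gFree m + 2 * gFree (m + 1) := by
    have := (abs_le.1 hV').1
    linarith
  have e : κ ^ 2 / ((m + 1 : ℕ) : ℝ) ^ 8 = 2 * (κ ^ 2 / 2 / ((m + 1 : ℕ) : ℝ) ^ 8) := by ring
  linarith

end Summit.QuantumFields.YangMills.Theorems.HankelDensitySplitting.LogWindow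

end
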